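import Literature.NumberTheory.Sieve.PolymathGEHCutoffDef
import Literature.NumberTheory.Sieve.PolymathBoundedGaps
import Mathlib.Tactic.Ring
import Mathlib.Tactic.Linarith
import HarnessLib

/-!
# The cutoff of Polymath 8b, Theorem 3.15 — symmetry, support, measurability, integrability

Trunk AntSieve, continuation of `PolymathGEHCutoffDef.lean` (D. H. J. Polymath, *Variants of the
Selberg sieve, and bounded intervals containing many primes*, Res. Math. Sci. 1:12 (2014) =
arXiv:1407.4897, Theorem 3.15 and §7.4), toward the named fact
`Literature.NumberTheory.Sieve.weakDHL_three_two_of_GEH` (Theorem 3.2(xii)).  For the explicit cutoff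
`F3` defined there we prove the qualitative properties required of a test function in Theorems
3.14/3.15 ("symmetric in the `t₁, t₂, t₃` variables", "supported on the simplex `(3/2)·R₃`",
square-integrable):

* `F3_swap01`, `F3_swap12`, `F3_swap02` — symmetry under the transpositions (hence under `S₃`), and
  `rearr_…` — the rearrangements as compositions with explicit permutations of `Fin 3`;
* `F3_sq` — `F² = Σ_{rearrangements} Gsq`, no cross terms (at most one rearrangement of a point lies
  in the open region `R_{xyz}`), the identity behind `I(F) = 3!·I(F↾R_{xyz})` (p. 32);
* `pos_of_F3_ne_zero`, `support_F3_subset` — `supp F ⊆ (3/2)·R₃` (`scaledSimplex 3 (3/2)`);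
* `measurable_F3`, `exists_bound_F3`, `integrable_F3`, `integrable_F3_sq`, `integrable_fibre`.

## References

* [Polymath8b2014] D. H. J. Polymath, Res. Math. Sci. 1 (2014), Art. 12 = arXiv:1407.4897,
  Theorem 3.15 (p. 11), §7.4 (pp. 31–34).
-/

noncomputable section

open MeasureTheory

namespace Literature.NumberTheory.Sieve

namespace GEHCutoff

/-! ### Symmetry of `F3` -/

/-- `F3` is invariant under swapping the first two coordinates. [cite: Polymath8b2014, Theorem 3.15] -/
theorem F3_swap01 (t : Fin 3 → ℝ) : F3 ![t 1, t 0, t 2] = F3 t := by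
  simp only [F3, Matrix.cons_val_zero, Matrix.cons_val_one, Matrix.cons_val_two, Matrix.head_cons,
    Matrix.tail_cons]
  ring

/-- `F3` is invariant under swapping the last two coordinates. [cite: Polymath8b2014, Theorem 3.15] -/
theorem F3_swap12 (t : Fin 3 → ℝ) : F3 ![t 0, t 2, t 1] = F3 t := by
  simp only [F3, Matrix.cons_val_zero, Matrix.cons_val_one, Matrix.cons_val_two, Matrix.head_cons,
    Matrix.tail_cons]
  ring

/-- `F3` is invariant under swapping the first and last coordinates. [cite: Polymath8b2014, Theorem 3.15] -/
theorem F3_swap02 (t : Fin 3 → ℝ) : F3 ![t 2, t 1, t 0] = F3 t := by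
  simp only [F3, Matrix.cons_val_zero, Matrix.cons_val_one, Matrix.cons_val_two, Matrix.head_cons,
    Matrix.tail_cons]
  ring

/-- `F3` at the trivial rearrangement. [folklore] -/
theorem F3_eta (t : Fin 3 → ℝ) : F3 ![t 0, t 1, t 2] = F3 t := by
  simp only [F3, Matrix.cons_val_zero, Matrix.cons_val_one, Matrix.cons_val_two, Matrix.head_cons,
    Matrix.tail_cons]

/-- The rearrangement `(t₁, t₀, t₂)` as a composition with a permutation. [folklore] -/
theorem rearr_102 (t : Fin 3 → ℝ) : (fun k => t (Equiv.swap (0 : Fin 3) 1 k)) = ![t 1, t 0, t 2] := by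
  funext k; fin_cases k <;> rfl

/-- The rearrangement `(t₀, t₂, t₁)` as a composition with a permutation. [folklore] -/
theorem rearr_021 (t : Fin 3 → ℝ) : (fun k => t (Equiv.swap (1 : Fin 3) 2 k)) = ![t 0, t 2, t 1] := by
  funext k; fin_cases k <;> rfl

/-- The rearrangement `(t₂, t₁, t₀)` as a composition with a permutation. [folklore] -/
theorem rearr_210 (t : Fin 3 → ℝ) : (fun k => t (Equiv.swap (0 : Fin 3) 2 k)) = ![t 2, t 1, t 0] := by
  funext k; fin_cases k <;> rfl

/-- The rearrangement `(t₁, t₂, t₀)` as a composition with a permutation. [folklore] -/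
theorem rearr_120 (t : Fin 3 → ℝ) :
    (fun k => t (((Equiv.swap (1 : Fin 3) 2).trans (Equiv.swap (0 : Fin 3) 1)) k)) = ![t 1, t 2, t 0] := by
  funext k; fin_cases k <;> rfl

/-- The rearrangement `(t₂, t₀, t₁)` as a composition with a permutation. [folklore] -/
theorem rearr_201 (t : Fin 3 → ℝ) :
    (fun k => t (((Equiv.swap (0 : Fin 3) 1).trans (Equiv.swap (1 : Fin 3) 2)) k)) = ![t 2, t 0, t 1] := by
  funext k; fin_cases k <;> rfl

/-! ### The square of `F3`: no cross terms between different rearrangements -/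

/-- Where `Gfun ≠ 0` the point lies in `R_{xyz}`. [cite: Polymath8b2014, Section 7.4] -/
theorem ordered_of_Gfun_ne_zero {s : Fin 3 → ℝ} (h : Gfun s ≠ 0) :
    (0 < s 1 ∧ s 1 < s 0 ∧ s 0 < s 2) ∧ s 0 + s 1 + s 2 < 3 / 2 := by
  constructor
  · by_contra hc
    exact h (Gfun_eq_zero_of_not_ordered hc)
  · by_contra hc
    exact h (Gfun_eq_zero_of_le_sum (not_lt.1 hc))

/-- Expanding a square of six terms all of whose pairwise products vanish. [folklore] -/
theorem sq_sum_six {a b c d e f : ℝ} (h1 : a * b = 0) (h2 : a * c = 0) (h3 : a * d = 0) (h4 : a * e = 0)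
    (h5 : a * f = 0) (h6 : b * c = 0) (h7 : b * d = 0) (h8 : b * e = 0) (h9 : b * f = 0) (h10 : c * d = 0)
    (h11 : c * e = 0) (h12 : c * f = 0) (h13 : d * e = 0) (h14 : d * f = 0) (h15 : e * f = 0) :
    (a + b + c + d + e + f) ^ 2 = a ^ 2 + b ^ 2 + c ^ 2 + d ^ 2 + e ^ 2 + f ^ 2 := by
  linear_combination (2 : ℝ) * h1 + 2 * h2 + 2 * h3 + 2 * h4 + 2 * h5 + 2 * h6 + 2 * h7 + 2 * h8 + 2 * h9 +
    2 * h10 + 2 * h11 + 2 * h12 + 2 * h13 + 2 * h14 + 2 * h15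

/-- A product `Gfun s · Gfun s'` vanishes unless both points are ordered. [folklore] -/
theorem Gfun_mul_eq_zero {s s' : Fin 3 → ℝ}
    (h : (0 < s 1 ∧ s 1 < s 0 ∧ s 0 < s 2) → (0 < s' 1 ∧ s' 1 < s' 0 ∧ s' 0 < s' 2) → False) :
    Gfun s * Gfun s' = 0 := by
  by_cases hs : Gfun s = 0
  · rw [hs, zero_mul]
  by_cases hs' : Gfun s' = 0
  · rw [hs', mul_zero]
  exact (h (ordered_of_Gfun_ne_zero hs).1 (ordered_of_Gfun_ne_zero hs').1).elim

/-- **`F3² = Σ_rearrangements Gsq`**: at most one rearrangement of a point is ordered.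
[cite: Polymath8b2014, Section 7.4] -/
theorem F3_sq (t : Fin 3 → ℝ) :
    F3 t ^ 2 = Gsq ![t 0, t 1, t 2] + Gsq ![t 1, t 0, t 2] + Gsq ![t 0, t 2, t 1] + Gsq ![t 2, t 1, t 0] +
      Gsq ![t 1, t 2, t 0] + Gsq ![t 2, t 0, t 1] := by
  simp only [F3, ← Gfun_sq]
  apply sq_sum_six <;>
  · apply Gfun_mul_eq_zero
    simp only [Matrix.cons_val_zero, Matrix.cons_val_one, Matrix.cons_val_two, Matrix.head_cons,
      Matrix.tail_cons]
    rintro ⟨a1, a2, a3⟩ ⟨b1, b2, b3⟩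
    linarith

/-! ### Support, measurability, boundedness, integrability -/

/-- **Support**: where `F3 ≠ 0` all coordinates are positive and their sum is `< 3/2`; in particular
`F3` is supported in `(3/2)·R₃`. [cite: Polymath8b2014, Theorem 3.15] -/
theorem pos_of_F3_ne_zero {t : Fin 3 → ℝ} (h : F3 t ≠ 0) :
    (0 < t 0 ∧ 0 < t 1 ∧ 0 < t 2) ∧ t 0 + t 1 + t 2 < 3 / 2 := by
  simp only [F3] at h
  -- one of the six terms is nonzero
  have H : ∀ a b c : ℝ, Gfun ![a, b, c] ≠ 0 → (0 < a ∧ 0 < b ∧ 0 < c) ∧ a + b + c < 3 / 2 := by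
    intro a b c hne
    have := ordered_of_Gfun_ne_zero hne
    simp only [Matrix.cons_val_zero, Matrix.cons_val_one, Matrix.cons_val_two, Matrix.head_cons,
      Matrix.tail_cons] at this
    obtain ⟨⟨h1, h2, h3⟩, h4⟩ := this
    exact ⟨⟨by linarith, by linarith, by linarith⟩, h4⟩
  by_cases g1 : Gfun ![t 0, t 1, t 2] ≠ 0
  · obtain ⟨⟨a, b, c⟩, d⟩ := H _ _ _ g1; exact ⟨⟨a, b, c⟩, by linarith⟩
  by_cases g2 : Gfun ![t 1, t 0, t 2] ≠ 0
  · obtain ⟨⟨a, b, c⟩, d⟩ := H _ _ _ g2; exact ⟨⟨b, a, c⟩, by linarith⟩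
  by_cases g3 : Gfun ![t 0, t 2, t 1] ≠ 0
  · obtain ⟨⟨a, b, c⟩, d⟩ := H _ _ _ g3; exact ⟨⟨a, c, b⟩, by linarith⟩
  by_cases g4 : Gfun ![t 2, t 1, t 0] ≠ 0
  · obtain ⟨⟨a, b, c⟩, d⟩ := H _ _ _ g4; exact ⟨⟨c, b, a⟩, by linarith⟩
  by_cases g5 : Gfun ![t 1, t 2, t 0] ≠ 0
  · obtain ⟨⟨a, b, c⟩, d⟩ := H _ _ _ g5; exact ⟨⟨c, a, b⟩, by linarith⟩
  by_cases g6 : Gfun ![t 2, t 0, t 1] ≠ 0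
  · obtain ⟨⟨a, b, c⟩, d⟩ := H _ _ _ g6; exact ⟨⟨b, c, a⟩, by linarith⟩
  simp only [ne_eq, not_not] at g1 g2 g3 g4 g5 g6
  rw [g1, g2, g3, g4, g5, g6] at h
  norm_num at h

/-- `F3` is supported in the scaled simplex `(3/2)·R₃`. [cite: Polymath8b2014, Theorem 3.15] -/
theorem support_F3_subset : Function.support F3 ⊆ scaledSimplex 3 (3 / 2) := by
  intro t ht
  obtain ⟨⟨h0, h1, h2⟩, hs⟩ := pos_of_F3_ne_zero ht
  refine ⟨fun k => ?_, ?_⟩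
  · fin_cases k
    · exact h0.le
    · exact h1.le
    · exact h2.le
  · rw [Fin.sum_univ_three]
    exact hs.le

/-- `F3` vanishes outside the box `[0, 3/2]³`. [folklore] -/
theorem F3_eq_zero_of_not_mem_box {t : Fin 3 → ℝ}
    (h : t ∉ Set.pi Set.univ fun _ : Fin 3 => Set.Icc (0 : ℝ) (3 / 2)) : F3 t = 0 := by
  by_contra hne
  obtain ⟨⟨h0, h1, h2⟩, hs⟩ := pos_of_F3_ne_zero hne
  apply h
  simp only [Set.mem_univ_pi, Set.mem_Icc]
  intro k
  fin_cases k
  · exact ⟨h0.le, by simp; linarith⟩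
  · exact ⟨h1.le, by simp; linarith⟩
  · exact ⟨h2.le, by simp; linarith⟩

/-- Each piece is a measurable set. [folklore] -/
theorem measurableSet_pieces :
    MeasurableSet pieceA ∧ MeasurableSet pieceB ∧ MeasurableSet pieceC ∧ MeasurableSet pieceE ∧
    MeasurableSet pieceS ∧ MeasurableSet pieceT ∧ MeasurableSet pieceU ∧ MeasurableSet pieceG ∧
    MeasurableSet pieceH := by
  have m0 : Measurable fun t : Fin 3 → ℝ => t 0 := measurable_pi_apply 0
  have m1 : Measurable fun t : Fin 3 → ℝ => t 1 := measurable_pi_apply 1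
  have m2 : Measurable fun t : Fin 3 → ℝ => t 2 := measurable_pi_apply 2
  refine ⟨?_, ?_, ?_, ?_, ?_, ?_, ?_, ?_, ?_⟩ <;>
  · simp only [pieceA, pieceB, pieceC, pieceE, pieceS, pieceT, pieceU, pieceG, pieceH, Set.setOf_and]
    repeat' apply MeasurableSet.inter
    all_goals
      first
      | exact measurableSet_lt measurable_const m1
      | exact measurableSet_lt m1 m0
      | exact measurableSet_lt m0 m2
      | exact measurableSet_lt ((m0.add m1).add m2) measurable_const
      | exact measurableSet_lt (m2.add m0) measurable_const
      | exact measurableSet_lt (m1.add m2) measurable_const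
      | exact measurableSet_lt (m0.add m1) measurable_const
      | exact measurableSet_lt measurable_const (m2.add m0)
      | exact measurableSet_lt measurable_const (m1.add m2)
      | exact measurableSet_lt measurable_const (m0.add m1)
      | exact measurableSet_lt m2 measurable_const
      | exact measurableSet_lt measurable_const m2
      | exact measurableSet_lt m0 measurable_const
      | exact measurableSet_lt measurable_const m0

/-- The polynomial pieces are continuous functions of the point. [folklore] -/
theorem continuous_polys :
    (Continuous fun t : Fin 3 → ℝ => polyA (t 0) (t 1) (t 2)) ∧
    (Continuous fun t : Fin 3 → ℝ => polyB (t 0) (t 1) (t 2)) ∧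
    (Continuous fun t : Fin 3 → ℝ => polyC (t 0) (t 1) (t 2)) ∧
    (Continuous fun t : Fin 3 → ℝ => polyE (t 0) (t 1) (t 2)) ∧
    (Continuous fun t : Fin 3 → ℝ => polyS (t 0) (t 1) (t 2)) ∧
    (Continuous fun t : Fin 3 → ℝ => polyT (t 0) (t 1) (t 2)) ∧
    (Continuous fun t : Fin 3 → ℝ => polyU (t 0) (t 1) (t 2)) ∧
    (Continuous fun t : Fin 3 → ℝ => polyG (t 0) (t 1) (t 2)) ∧
    (Continuous fun t : Fin 3 → ℝ => polyH (t 0) (t 1) (t 2)) := by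
  have c0 : Continuous fun t : Fin 3 → ℝ => t 0 := continuous_apply 0
  have c1 : Continuous fun t : Fin 3 → ℝ => t 1 := continuous_apply 1
  have c2 : Continuous fun t : Fin 3 → ℝ => t 2 := continuous_apply 2
  simp only [polyA, polyB, polyC, polyE, polyS, polyT, polyU, polyG, polyH]
  refine ⟨?_, ?_, ?_, ?_, ?_, ?_, ?_, ?_, ?_⟩ <;> fun_prop

/-- `Gfun` is measurable. [folklore] -/
theorem measurable_Gfun : Measurable Gfun := by
  obtain ⟨mA, mB, mC, mE, mS, mT, mU, mG, mH⟩ := measurableSet_pieces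
  obtain ⟨cA, cB, cC, cE, cS, cT, cU, cG, cH⟩ := continuous_polys
  unfold Gfun
  exact ((((((((cA.measurable.indicator mA).add (cB.measurable.indicator mB)).add
    (cC.measurable.indicator mC)).add (cE.measurable.indicator mE)).add (cS.measurable.indicator mS)).add
    (cT.measurable.indicator mT)).add (cU.measurable.indicator mU)).add (cG.measurable.indicator mG)).add
    (cH.measurable.indicator mH)

/-- Rearranging coordinates is measurable. [folklore] -/
theorem measurable_rearr (a b c : Fin 3) : Measurable fun t : Fin 3 → ℝ => ![t a, t b, t c] := by
  refine measurable_pi_lambda _ fun k => ?_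
  fin_cases k
  · simpa using measurable_pi_apply a
  · simpa using measurable_pi_apply b
  · simpa using measurable_pi_apply c

/-- **`F3` is measurable.** [cite: Polymath8b2014, Theorem 3.15] -/
theorem measurable_F3 : Measurable F3 := by
  unfold F3
  exact (((((measurable_Gfun.comp (measurable_rearr 0 1 2)).add (measurable_Gfun.comp (measurable_rearr 1 0 2))).add
    (measurable_Gfun.comp (measurable_rearr 0 2 1))).add (measurable_Gfun.comp (measurable_rearr 2 1 0))).add
    (measurable_Gfun.comp (measurable_rearr 1 2 0))).add (measurable_Gfun.comp (measurable_rearr 2 0 1))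

/-- A piece lies in the box `[0, 3/2]³` (all its points are ordered with sum `< 3/2`). [folklore] -/
theorem mem_box_of_Gfun_ne_zero {s : Fin 3 → ℝ} (h : Gfun s ≠ 0) :
    s ∈ Set.pi Set.univ fun _ : Fin 3 => Set.Icc (0 : ℝ) (3 / 2) := by
  obtain ⟨⟨h1, h2, h3⟩, hs⟩ := ordered_of_Gfun_ne_zero h
  simp only [Set.mem_univ_pi, Set.mem_Icc]
  intro k
  fin_cases k
  · exact ⟨by simp; linarith, by simp; linarith⟩
  · exact ⟨by simp; linarith, by simp; linarith⟩
  · exact ⟨by simp; linarith, by simp; linarith⟩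

/-- **`Gfun` is bounded.** [folklore] -/
theorem exists_bound_Gfun : ∃ C : ℝ, ∀ s, |Gfun s| ≤ C := by
  obtain ⟨cA, cB, cC, cE, cS, cT, cU, cG, cH⟩ := continuous_polys
  have hK : IsCompact (Set.pi Set.univ fun _ : Fin 3 => Set.Icc (0 : ℝ) (3 / 2)) :=
    isCompact_univ_pi fun _ => isCompact_Icc
  have hsum : Continuous fun t : Fin 3 → ℝ => |polyA (t 0) (t 1) (t 2)| + |polyB (t 0) (t 1) (t 2)| +
      |polyC (t 0) (t 1) (t 2)| + |polyE (t 0) (t 1) (t 2)| + |polyS (t 0) (t 1) (t 2)| + |polyT (t 0) (t 1) (t 2)| +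
      |polyU (t 0) (t 1) (t 2)| + |polyG (t 0) (t 1) (t 2)| + |polyH (t 0) (t 1) (t 2)| := by
    fun_prop
  obtain ⟨C, hC⟩ := hK.exists_bound_of_continuousOn hsum.continuousOn
  refine ⟨max C 0, fun s => ?_⟩
  by_cases hs : Gfun s = 0
  · rw [hs, abs_zero]; exact le_max_right _ _
  have hmem := mem_box_of_Gfun_ne_zero hs
  have hCs := hC s hmem
  rw [Real.norm_eq_abs] at hCs
  refine le_trans ?_ ((le_abs_self _).trans hCs |>.trans (le_max_left _ _))
  have tri : ∀ (S : Set (Fin 3 → ℝ)) (f : (Fin 3 → ℝ) → ℝ), |S.indicator f s| ≤ |f s| := by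
    intro S f
    by_cases hm : s ∈ S
    · rw [Set.indicator_of_mem hm]
    · rw [Set.indicator_of_notMem hm, abs_zero]; exact abs_nonneg _
  simp only [Gfun]
  exact ((abs_add_le _ _).trans (add_le_add ((abs_add_le _ _).trans (add_le_add ((abs_add_le _ _).trans (add_le_add ((abs_add_le _ _).trans (add_le_add ((abs_add_le _ _).trans (add_le_add ((abs_add_le _ _).trans (add_le_add ((abs_add_le _ _).trans (add_le_add ((abs_add_le _ _).trans (add_le_add (tri pieceA (fun t => polyA (t 0) (t 1) (t 2))) (tri pieceB (fun t => polyB (t 0) (t 1) (t 2))))) (tri pieceC (fun t => polyC (t 0) (t 1) (t 2))))) (tri pieceE (fun t => polyE (t 0) (t 1) (t 2))))) (tri pieceS (fun t => polyS (t 0) (t 1) (t 2))))) (tri pieceT (fun t => polyT (t 0) (t 1) (t 2))))) (tri pieceU (fun t => polyU (t 0) (t 1) (t 2))))) (tri pieceG (fun t => polyG (t 0) (t 1) (t 2))))) (tri pieceH (fun t => polyH (t 0) (t 1) (t 2)))))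

/-- **`F3` is bounded.** [cite: Polymath8b2014, Theorem 3.15] -/
theorem exists_bound_F3 : ∃ C : ℝ, ∀ t, |F3 t| ≤ C := by
  obtain ⟨C, hC⟩ := exists_bound_Gfun
  refine ⟨6 * C, fun t => ?_⟩
  simp only [F3]
  have h1 := hC ![t 0, t 1, t 2]; have h2 := hC ![t 1, t 0, t 2]; have h3 := hC ![t 0, t 2, t 1]
  have h4 := hC ![t 2, t 1, t 0]; have h5 := hC ![t 1, t 2, t 0]; have h6 := hC ![t 2, t 0, t 1]
  have E : |Gfun ![t 0, t 1, t 2] + Gfun ![t 1, t 0, t 2] + Gfun ![t 0, t 2, t 1] + Gfun ![t 2, t 1, t 0] +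
      Gfun ![t 1, t 2, t 0] + Gfun ![t 2, t 0, t 1]| ≤ |Gfun ![t 0, t 1, t 2]| + |Gfun ![t 1, t 0, t 2]| +
      |Gfun ![t 0, t 2, t 1]| + |Gfun ![t 2, t 1, t 0]| + |Gfun ![t 1, t 2, t 0]| + |Gfun ![t 2, t 0, t 1]| :=
    (abs_add_le _ _).trans (add_le_add ((abs_add_le _ _).trans (add_le_add ((abs_add_le _ _).trans
      (add_le_add ((abs_add_le _ _).trans (add_le_add (abs_add_le _ _) le_rfl)) le_rfl)) le_rfl)) le_rfl)
  linarith

open MeasureTheory in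
/-- A bounded measurable function vanishing off the box `[0, 3/2]³` is integrable. [folklore] -/
theorem integrable_of_bounded_box {f : (Fin 3 → ℝ) → ℝ} (hf : Measurable f) {C : ℝ} (hC : ∀ t, |f t| ≤ C)
    (h0 : ∀ t, t ∉ (Set.pi Set.univ fun _ : Fin 3 => Set.Icc (0 : ℝ) (3 / 2)) → f t = 0) : Integrable f := by
  set K := Set.pi Set.univ fun _ : Fin 3 => Set.Icc (0 : ℝ) (3 / 2)
  have hK : IsCompact K := isCompact_univ_pi fun _ => isCompact_Icc
  have hsupp : Function.support f ⊆ K := fun t ht => by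
    by_contra hn
    exact ht (h0 t hn)
  rw [← integrableOn_iff_integrable_of_support_subset hsupp]
  refine Measure.integrableOn_of_bounded (M := C) hK.measure_lt_top.ne hf.aestronglyMeasurable ?_
  exact Filter.Eventually.of_forall fun t => (Real.norm_eq_abs _).le.trans (hC t)

open MeasureTheory in
/-- **`F3` is integrable.** [cite: Polymath8b2014, Theorem 3.15] -/
theorem integrable_F3 : Integrable F3 := by
  obtain ⟨C, hC⟩ := exists_bound_F3
  exact integrable_of_bounded_box measurable_F3 hC fun t ht => F3_eq_zero_of_not_mem_box ht

open MeasureTheory in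
/-- **`F3²` is integrable.** [cite: Polymath8b2014, Theorem 3.15] -/
theorem integrable_F3_sq : Integrable fun t => F3 t ^ 2 := by
  obtain ⟨C, hC⟩ := exists_bound_F3
  refine integrable_of_bounded_box (measurable_F3.pow_const 2) (C := C ^ 2) (fun t => ?_) fun t ht => ?_
  · rw [abs_pow]
    exact pow_le_pow_left₀ (abs_nonneg _) (hC t) 2
  · rw [F3_eq_zero_of_not_mem_box ht]; ring

open MeasureTheory in
/-- **Every fibre `u ↦ F(x, y, u)` is integrable.** [cite: Polymath8b2014, Theorem 3.15] -/
theorem integrable_fibre (x y : ℝ) : Integrable fun u : ℝ => F3 ![x, y, u] := by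
  obtain ⟨C, hC⟩ := exists_bound_F3
  have hm : Measurable fun u : ℝ => F3 ![x, y, u] := by
    refine measurable_F3.comp (measurable_pi_lambda _ fun k => ?_)
    fin_cases k <;> simp
    fun_prop
  have hsupp : Function.support (fun u : ℝ => F3 ![x, y, u]) ⊆ Set.Icc 0 (3 / 2) := by
    intro u hu
    have := pos_of_F3_ne_zero hu
    simp only [Matrix.cons_val_zero, Matrix.cons_val_one, Matrix.cons_val_two, Matrix.head_cons,
      Matrix.tail_cons] at this
    obtain ⟨⟨h0, h1, h2⟩, hs⟩ := this
    exact ⟨h2.le, by linarith⟩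
  rw [← integrableOn_iff_integrable_of_support_subset hsupp]
  refine Measure.integrableOn_of_bounded (M := C) measure_Icc_lt_top.ne hm.aestronglyMeasurable ?_
  exact Filter.Eventually.of_forall fun u => (Real.norm_eq_abs _).le.trans (hC _)

end GEHCutoff

end Literature.NumberTheory.Sieve
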